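import Mathlib
import HarnessLib
import Literature.Analysis.FluidPDE.DriftPressureIdentification
import Literature.Analysis.FluidPDE.PressureNormalisationL3
import Literature.Analysis.FluidPDE.ClassicalSolutionCalculus
import Literature.Analysis.FluidPDE.SpaceTimeMollifier
import Summits.NavierStokesRegularity.NavierStokesRegularity.Theorems.PoloidalWindowDoorPoloidalWindowRigidityLargeScaleMomentum
import Summits.NavierStokesRegularity.NavierStokesRegularity.Theorems.PoloidalWindowDoorPoloidalWindowRigiditySliceFunctionalScale

/-!
# Route `PoloidalWindowDoor`, crux `PoloidalWindowRigidity` (K2, stmt-NavierStokesRegularity-19708) —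
# THE PRESSURE-GRADIENT IDENTITY of bounded Oseen-mild classical solutions: `∇p = ∇Σℛᵢℛⱼ(uᵢuⱼ)`

Cell ns-regularity-ideate, seat nsreg-p7 (gen 6, third worker under the K2 lead; `--supports stmt-…-19708`).
The decisive brick of the discharge of the K2 lead's hypothesis (F1) (`…LargeScaleEnergy`, `hBMO`): for a
classical solution `(u, p)` of the unit-viscosity unforced Navier–Stokes system on an open time set, bounded
near the time `τ` and satisfying there the KERNEL-FORM Oseen identity (M) of the route's Type-I class, the slice
pressure-gradient identities of Fernández-Dalgo–Lemarié-Rieusset / Kang–Miura–Tsai hold at `τ`: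

  `∫ [p(τ,x) ∂ₑλ_δ(c − x) + D³Φ_δ(c − x)(e)(u(τ,x), u(τ,x))] dx = 0`   for all `δ > 0`, `c`, `e`

(`sliceFunctional_eq_zero_of_mild`; `Φ_δ = newtonReg δ`, `λ_δ = ΔΦ_δ`) — the mollified statement
`∇p(τ) = ∇Σℛᵢℛⱼ(uᵢuⱼ)(τ)`, which the tree so far had only for spatially DECAYING (local Leray) solutions
(`IsLocalLeraySolutionOn.ae_slice_pgIdentity`).  Proof: the functional does not depend on `δ`
(`…SliceFunctionalScale`), so take `δ = R` large.  The velocity part is `O(M²/R)` (`…ProfileScaling`).  The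
pressure part is `∫ ∂ₑp θ_R` (`θ_R = λ_R(c − ·)`), and `∂ₑp = ⟪Δu − ∂ₜu − (u·∇)u, e⟫` (momentum equation):
the Laplacian and convection terms integrate by parts onto `θ_R` (`O(M/R²)`, `O(M²/R)`), and the time-derivative
term is the derivative of the large-scale mean `σ ↦ ∫⟪u(σ), θ_R e⟫`, whose Lipschitz constant is `O((M+M²)/R)` by
the LARGE-SCALE MOMENTUM CONSERVATION of Oseen-mild fields (`…LargeScaleMomentum`).  Letting `R → ∞` gives `0`.
No harmonic-function Liouville theorem and no spatial decay are used: (M) alone kills the affine pressure gauge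
(for the drift `c(t)e₃`, `p = −c′(t)x₃` of the negative lane the functional equals `−c′(t)⟪e₃,e⟫ ≠ 0`).

WHAT THIS IS NOT: not a claim about Navier–Stokes regularity and not the open residue S2⁗ — the
identification of the pressure of bounded mild solutions (bears_on LADDER-NS N0 via crux K2 = stmt-19708).
-/

noncomputable section

-- the summit and its single sub-problem share the name (CONVENTIONS §1), as in every Theorems file
set_option linter.dupNamespace false
-- nested operator types `ℝ³ →L[ℝ] ℝ³ →L[ℝ] ℝ³ →L[ℝ] ℝ`
set_option maxSynthPendingDepth 3

namespace Summit.NavierStokesRegularity.NavierStokesRegularity.Theorems.PoloidalWindowDoorPoloidalWindowRigidityPressureGradientIdentity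

open MeasureTheory Set Function Filter Topology Metric InnerProductSpace
open scoped RealInnerProductSpace ENNReal NNReal Laplacian ContDiff
open Literature.Analysis Literature.Analysis.FluidPDE Literature.Analysis.UnboundedOperators
open Summit.NavierStokesRegularity.NavierStokesRegularity.Theorems.PoloidalWindowDoorPoloidalWindowRigidityPressureGaugeTools
open Summit.NavierStokesRegularity.NavierStokesRegularity.Theorems.PoloidalWindowDoorPoloidalWindowRigidityProfileScaling
open Summit.NavierStokesRegularity.NavierStokesRegularity.Theorems.PoloidalWindowDoorPoloidalWindowRigiditySliceFunctionalScale
open Summit.NavierStokesRegularity.NavierStokesRegularity.Theorems.PoloidalWindowDoorPoloidalWindowRigidityLargeScaleMomentum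

/-! ## Elementary bounds for the Laplacian and convection terms -/

section Terms

variable {v : EuclideanSpace ℝ (Fin 3) → EuclideanSpace ℝ (Fin 3)} {θ : EuclideanSpace ℝ (Fin 3) → ℝ} {M : ℝ}

/-- A bounded field is uniformly locally `L²`: `∫_{B(z,1)} |w|² ≤ M² |B₁|`. [folklore] -/
theorem lintegral_ball_le_of_bound {w : EuclideanSpace ℝ (Fin 3) → EuclideanSpace ℝ (Fin 3)}
    (hM : ∀ y, ‖w y‖ ≤ M) (z : EuclideanSpace ℝ (Fin 3)) :
    ∫⁻ y in ball z 1, ‖w y‖ₑ ^ 2 ≤ ENNReal.ofReal (M ^ 2) * volume (ball (0 : EuclideanSpace ℝ (Fin 3)) 1) := by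
  have hM0 : 0 ≤ M := (norm_nonneg _).trans (hM 0)
  calc ∫⁻ y in ball z 1, ‖w y‖ₑ ^ 2 ≤ ∫⁻ y in ball z 1, ENNReal.ofReal (M ^ 2) := by
        refine lintegral_mono fun y => ?_
        rw [← ofReal_norm, ← ENNReal.ofReal_pow (norm_nonneg _)]
        exact ENNReal.ofReal_le_ofReal (pow_le_pow_left₀ (norm_nonneg _) (hM y) 2)
    _ = ENNReal.ofReal (M ^ 2) * volume (ball (0 : EuclideanSpace ℝ (Fin 3)) 1) := by
        rw [setLIntegral_const, Measure.addHaar_ball_center]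

/-- **Laplacian term:** `|∫ ⟪Δv, e⟫ θ| ≤ M ‖e‖ ∫‖Δθ‖` for `v ∈ C²` bounded by `M` and a test function `θ`
(Green twice). [folklore] -/
theorem abs_integral_inner_laplacian_mul_le (hv : ContDiff ℝ 2 v) (hM : ∀ y, ‖v y‖ ≤ M)
    (hθ : FunctionSpaces.IsTestFunctionOn (⊤ : TopologicalSpace.Opens (EuclideanSpace ℝ (Fin 3))) θ)
    (e : EuclideanSpace ℝ (Fin 3)) :
    |∫ x, ⟪Δ v x, e⟫ * θ x| ≤ M * ‖e‖ * ∫ x, ‖Δ θ x‖ := by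
  have hM0 : 0 ≤ M := (norm_nonneg _).trans (hM 0)
  have hθ2 : ContDiff ℝ 2 θ := contDiff_infty.1 hθ.contDiff 2
  have hwc : HasCompactSupport fun x => θ x • e := hθ.hasCompactSupport.smul_right
  have hΔc : Continuous (Δ θ) := FluidPDE.continuous_laplacian hθ2
  have hΔs : HasCompactSupport (Δ θ) := hθ.hasCompactSupport.mono' fun z hz => by
    contrapose! hz
    simp [FluidPDE.laplacian_eq_zero_of_notMem_tsupport hz]
  have h1 : ∫ x, ⟪Δ v x, e⟫ * θ x = ∫ x, ⟪Δ v x, θ x • e⟫ := by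
    refine integral_congr_ae (Eventually.of_forall fun x => ?_)
    dsimp only
    rw [real_inner_smul_right, mul_comm]
  have hw2 : ContDiff ℝ 2 (fun x => θ x • e) := hθ2.smul contDiff_const
  have h2 : ∫ x, ⟪Δ v x, θ x • e⟫ = ∫ x, Δ θ x * ⟪v x, e⟫ := by
    rw [integral_inner_laplacian_comm hv hw2 hwc]
    refine integral_congr_ae (Eventually.of_forall fun x => ?_)
    dsimp only
    rw [laplacian_smul_const hθ2, real_inner_smul_right]
  rw [h1, h2]
  have hint : Integrable (fun x => M * ‖e‖ * ‖Δ θ x‖) volume := (hΔc.norm.integrable_of_hasCompactSupport hΔs.norm).const_mul _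
  have hpt : ∀ x, ‖Δ θ x * ⟪v x, e⟫‖ ≤ M * ‖e‖ * ‖Δ θ x‖ := by
    intro x
    rw [norm_mul]
    calc ‖Δ θ x‖ * ‖⟪v x, e⟫‖ ≤ ‖Δ θ x‖ * (‖v x‖ * ‖e‖) :=
          mul_le_mul_of_nonneg_left (norm_inner_le_norm _ _) (norm_nonneg _)
      _ ≤ ‖Δ θ x‖ * (M * ‖e‖) := by gcongr; exact hM x
      _ = M * ‖e‖ * ‖Δ θ x‖ := by ring
  rw [← Real.norm_eq_abs, ← integral_const_mul]
  exact norm_integral_le_of_norm_le hint (Eventually.of_forall hpt)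

/-- **Convection term:** `|∫ ⟪(v·∇)v, e⟫ θ| ≤ M² ‖e‖ ∫‖Dθ‖` for a divergence-free `v ∈ C¹` bounded by `M`
and a test function `θ` (`∫⟪(v·∇)v, θe⟫ = −∫⟪v, (∂ᵥθ) e⟫`). [folklore] -/
theorem abs_integral_inner_convect_mul_le (hv : ContDiff ℝ 1 v) (hdiv : VectorCalculus.IsDivFree v)
    (hM : ∀ y, ‖v y‖ ≤ M)
    (hθ : FunctionSpaces.IsTestFunctionOn (⊤ : TopologicalSpace.Opens (EuclideanSpace ℝ (Fin 3))) θ)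
    (e : EuclideanSpace ℝ (Fin 3)) :
    |∫ x, ⟪convect v v x, e⟫ * θ x| ≤ M ^ 2 * ‖e‖ * ∫ x, ‖fderiv ℝ θ x‖ := by
  have hM0 : 0 ≤ M := (norm_nonneg _).trans (hM 0)
  have hθ1 : ContDiff ℝ 1 θ := contDiff_infty.1 hθ.contDiff 1
  have hw1 : ContDiff ℝ 1 fun x => θ x • e := hθ1.smul contDiff_const
  have hwc : HasCompactSupport fun x => θ x • e := hθ.hasCompactSupport.smul_right
  have hDc : Continuous (fderiv ℝ θ) := hθ1.continuous_fderiv one_ne_zero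
  have hDs : HasCompactSupport (fderiv ℝ θ) := hθ.hasCompactSupport.fderiv (𝕜 := ℝ)
  have h1 : ∫ x, ⟪convect v v x, e⟫ * θ x = ∫ x, ⟪convect v v x, θ x • e⟫ := by
    refine integral_congr_ae (Eventually.of_forall fun x => ?_)
    dsimp only
    rw [real_inner_smul_right, mul_comm]
  have h := integral_inner_convect_add_eq_zero hv hv hw1 hwc
  have hdiv0 : ∫ x, VectorCalculus.divergence v x * ⟪v x, θ x • e⟫ = 0 := by
    rw [integral_eq_zero_of_ae (Eventually.of_forall fun x => by simp [hdiv x])]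
  rw [hdiv0, add_zero] at h
  have hconv : ∀ x, convect v (fun x => θ x • e) x = (fderiv ℝ θ x (v x)) • e := by
    intro x
    rw [convect_smul_apply ((hθ1.differentiable one_ne_zero) x) (differentiableAt_const e)]
    simp [convect]
  have h2 : ∫ x, ⟪convect v v x, θ x • e⟫ = -∫ x, fderiv ℝ θ x (v x) * ⟪v x, e⟫ := by
    have h3 : ∫ x, ⟪v x, convect v (fun x => θ x • e) x⟫ = ∫ x, fderiv ℝ θ x (v x) * ⟪v x, e⟫ := by
      refine integral_congr_ae (Eventually.of_forall fun x => ?_)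
      dsimp only
      rw [hconv, real_inner_smul_right]
    linarith
  rw [h1, h2, abs_neg]
  have hint : Integrable (fun x => M ^ 2 * ‖e‖ * ‖fderiv ℝ θ x‖) volume :=
    (hDc.norm.integrable_of_hasCompactSupport hDs.norm).const_mul _
  have hpt : ∀ x, ‖fderiv ℝ θ x (v x) * ⟪v x, e⟫‖ ≤ M ^ 2 * ‖e‖ * ‖fderiv ℝ θ x‖ := by
    intro x
    rw [norm_mul]
    calc ‖fderiv ℝ θ x (v x)‖ * ‖⟪v x, e⟫‖ ≤ (‖fderiv ℝ θ x‖ * ‖v x‖) * (‖v x‖ * ‖e‖) :=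
          mul_le_mul (ContinuousLinearMap.le_opNorm _ _) (norm_inner_le_norm _ _) (norm_nonneg _) (by positivity)
      _ ≤ (‖fderiv ℝ θ x‖ * M) * (M * ‖e‖) := by gcongr <;> exact hM x
      _ = M ^ 2 * ‖e‖ * ‖fderiv ℝ θ x‖ := by ring
  rw [← Real.norm_eq_abs, ← integral_const_mul]
  exact norm_integral_le_of_norm_le hint (Eventually.of_forall hpt)

end Terms

/-! ## The pressure-gradient identity -/

section Identity

variable {S : Set ℝ} {u : ℝ → EuclideanSpace ℝ (Fin 3) → EuclideanSpace ℝ (Fin 3)}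
  {p : ℝ → EuclideanSpace ℝ (Fin 3) → ℝ} {τ η M : ℝ}

/-- **The time-derivative term is controlled by large-scale momentum conservation.** For a classical
solution on an open `S ⊇ [τ−η, τ+η]`, bounded by `M` there and Oseen-mild between any two of these times, and a
test function `θ`: `|∫ ⟪∂ₜu(τ), e⟫ θ| ≤ ‖e‖ [M∫‖Δθ‖ + M²(∫‖Dθ‖ + 2^{3/2}·2R∫‖D²θ‖ + K_Θ(2/R)∫|θ|)]`
(the derivative of the Lipschitz function `σ ↦ ∫⟪u(σ), θe⟫`). [folklore] -/
theorem abs_integral_inner_timeDeriv_mul_le (hS : IsOpen S) (hcl : IsClassicalNSSolutionOn S 1 0 u p)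
    (hη : 0 < η) (hI : Icc (τ - η) (τ + η) ⊆ S) (hM0 : 0 ≤ M)
    (hM : ∀ σ ∈ Icc (τ - η) (τ + η), ∀ y, ‖u σ y‖ ≤ M)
    (hmild : ∀ s t : ℝ, s ∈ Icc (τ - η) (τ + η) → t ∈ Icc (τ - η) (τ + η) → s < t → ∀ x,
      u t x = heatExtension (u s) (t - s) x - oseenDuhamel 1 s u u t x)
    {θ : EuclideanSpace ℝ (Fin 3) → ℝ}
    (hθ : FunctionSpaces.IsTestFunctionOn (⊤ : TopologicalSpace.Opens (EuclideanSpace ℝ (Fin 3))) θ)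
    (e : EuclideanSpace ℝ (Fin 3)) {R : ℝ} (hR : 0 < R) :
    |∫ x, ⟪timeDerivWithin S u τ x, e⟫ * θ x| ≤
      ‖e‖ * (M * (∫ x, ‖Δ θ x‖) + M ^ 2 * ((∫ x, ‖fderiv ℝ θ x‖) +
        (2 : ℝ) ^ ((Module.finrank ℝ (EuclideanSpace ℝ (Fin 3)) : ℝ) / 2) * (2 * R) *
          (∫ x, ‖fderiv ℝ (fderiv ℝ θ) x‖) +
        ((3 / 2) * (2 : ℝ) ^ ((Module.finrank ℝ (EuclideanSpace ℝ (Fin 3)) : ℝ) / 2) +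
          8 * 64 * ((2 : ℝ) ^ ((Module.finrank ℝ (EuclideanSpace ℝ (Fin 3)) : ℝ) / 2)) ^ 3) * (2 / R) *
          ∫ x, |θ x|)) := by
  set L : ℝ := ‖e‖ * (M * (∫ x, ‖Δ θ x‖) + M ^ 2 * ((∫ x, ‖fderiv ℝ θ x‖) +
        (2 : ℝ) ^ ((Module.finrank ℝ (EuclideanSpace ℝ (Fin 3)) : ℝ) / 2) * (2 * R) *
          (∫ x, ‖fderiv ℝ (fderiv ℝ θ) x‖) +
        ((3 / 2) * (2 : ℝ) ^ ((Module.finrank ℝ (EuclideanSpace ℝ (Fin 3)) : ℝ) / 2) +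
          8 * 64 * ((2 : ℝ) ^ ((Module.finrank ℝ (EuclideanSpace ℝ (Fin 3)) : ℝ) / 2)) ^ 3) * (2 / R) *
          ∫ x, |θ x|)) with hL
  have hL0 : 0 ≤ L := by
    have h1 : 0 ≤ ∫ x, ‖Δ θ x‖ := integral_nonneg fun _ => norm_nonneg _
    have h2 : 0 ≤ ∫ x, ‖fderiv ℝ θ x‖ := integral_nonneg fun _ => norm_nonneg _
    have h3 : 0 ≤ ∫ x, ‖fderiv ℝ (fderiv ℝ θ) x‖ := integral_nonneg fun _ => norm_nonneg _
    have h4 : 0 ≤ ∫ x, |θ x| := integral_nonneg fun _ => abs_nonneg _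
    positivity
  have hτ : τ ∈ S := hI ⟨by linarith, by linarith⟩
  -- the large-scale mean and its derivative
  set Ψ : EuclideanSpace ℝ (Fin 3) → EuclideanSpace ℝ (Fin 3) := fun y => θ y • e with hΨ
  have hΨs : ContDiff ℝ ∞ Ψ := hθ.contDiff.smul contDiff_const
  have hΨc : HasCompactSupport Ψ := hθ.hasCompactSupport.smul_right
  have hΨi : Integrable Ψ volume := hΨs.continuous.integrable_of_hasCompactSupport hΨc
  set Φ : ℝ → ℝ := fun σ => ∫ y, ⟪u σ y, Ψ y⟫ with hΦ
  have hder : HasDerivAt Φ (∫ y, ⟪timeDerivWithin S u τ y, Ψ y⟫) τ :=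
    PressureNormalisationL3.hasDerivAt_integral_inner_velocity hcl hS hΨs hΨc hτ
  have heq : ∫ x, ⟪timeDerivWithin S u τ x, e⟫ * θ x = ∫ y, ⟪timeDerivWithin S u τ y, Ψ y⟫ := by
    refine integral_congr_ae (Eventually.of_forall fun x => ?_)
    simp only [hΨ, real_inner_smul_right, mul_comm]
  rw [heq]
  -- the Lipschitz bound from momentum conservation
  have hcont : ContinuousOn (uncurry u) (S ×ˢ univ) := ContDiffOn.continuousOn hcl.smooth_velocity
  have hdiff : ∀ s t : ℝ, s ∈ Icc (τ - η) (τ + η) → t ∈ Icc (τ - η) (τ + η) → s < t →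
      |Φ t - Φ s| ≤ L * (t - s) := by
    intro s t hs ht hst
    have hsub : Icc s t ⊆ S := fun σ hσ => hI ⟨hs.1.trans hσ.1, hσ.2.trans ht.2⟩
    have hmeas : AEStronglyMeasurable (uncurry u)
        ((volume : Measure (ℝ × EuclideanSpace ℝ (Fin 3))).restrict (Ioo s t ×ˢ univ)) :=
      (hcont.mono (prod_mono (Ioo_subset_Icc_self.trans hsub) Subset.rfl)).aestronglyMeasurable
        (measurableSet_Ioo.prod MeasurableSet.univ)
    have hMst : ∀ σ ∈ Ioo s t, ∀ y, ‖u σ y‖ ≤ M := fun σ hσ =>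
      hM σ ⟨hs.1.trans hσ.1.le, hσ.2.le.trans ht.2⟩
    have hus : Continuous (u s) := (hcl.contDiff_velocity (hsub (left_mem_Icc.2 hst.le))).continuous
    have hut : Continuous (u t) := (hcl.contDiff_velocity (hsub (right_mem_Icc.2 hst.le))).continuous
    have key := abs_integral_mul_inner_sub_le hst hM0 hR hmeas hMst hus hut (hM s hs) (hM t ht)
      (hmild s t hs ht hst) hθ e
    have hit : Integrable (fun y => ⟪u t y, Ψ y⟫) volume := integrable_inner_of_bound hut.aestronglyMeasurable (hM t ht) hΨi
    have his : Integrable (fun y => ⟪u s y, Ψ y⟫) volume := integrable_inner_of_bound hus.aestronglyMeasurable (hM s hs) hΨi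
    have hΦeq : Φ t - Φ s = ∫ x, θ x * ⟪u t x - u s x, e⟫ := by
      simp only [hΦ]
      rw [← integral_sub hit his]
      refine integral_congr_ae (Eventually.of_forall fun x => ?_)
      simp only [hΨ, real_inner_smul_right, inner_sub_left]
      ring
    rw [hΦeq]
    calc |∫ x, θ x * ⟪u t x - u s x, e⟫| ≤ _ := key
      _ = L * (t - s) := by rw [hL]; ring
  have hlip : ∀ᶠ σ in 𝓝 τ, ‖Φ σ - Φ τ‖ ≤ L * ‖σ - τ‖ := by
    have hnb : Ioo (τ - η) (τ + η) ∈ 𝓝 τ := Ioo_mem_nhds (by linarith) (by linarith)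
    filter_upwards [hnb] with σ hσ
    have hσI : σ ∈ Icc (τ - η) (τ + η) := ⟨hσ.1.le, hσ.2.le⟩
    have hτI : τ ∈ Icc (τ - η) (τ + η) := ⟨by linarith, by linarith⟩
    rcases lt_trichotomy σ τ with hlt | heq' | hgt
    · rw [Real.norm_eq_abs, Real.norm_eq_abs, abs_sub_comm, abs_of_neg (by linarith : σ - τ < 0)]
      have h := hdiff σ τ hσI hτI hlt
      linarith
    · subst heq'; simp
    · rw [Real.norm_eq_abs, Real.norm_eq_abs, abs_of_pos (by linarith : 0 < σ - τ)]
      exact hdiff τ σ hτI hσI hgt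
  have hbound := hder.le_of_lip' hL0 hlip
  rwa [Real.norm_eq_abs] at hbound

/-- **THE PRESSURE-GRADIENT IDENTITY of bounded Oseen-mild classical solutions.** Let `(u, p)` be a classical
solution of the unit-viscosity unforced Navier–Stokes system on an open time set `S ⊇ [τ−η, τ+η]`, bounded by
`M` on `[τ−η, τ+η] × ℝ³`, satisfying the kernel-form Oseen identity between any two of these times. Then for
every `δ > 0`, centre `c` and direction `e`,
`∫ [p(τ,x) ∂ₑλ_δ(c − x) + D³Φ_δ(c − x)(e)(u(τ,x), u(τ,x))] dx = 0`
— the mollified form of `∇p(τ) = ∇Σℛᵢℛⱼ(uᵢuⱼ)(τ)`. [folklore] -/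
theorem sliceFunctional_eq_zero_of_mild (hS : IsOpen S) (hcl : IsClassicalNSSolutionOn S 1 0 u p)
    (hη : 0 < η) (hI : Icc (τ - η) (τ + η) ⊆ S) (hM0 : 0 ≤ M)
    (hM : ∀ σ ∈ Icc (τ - η) (τ + η), ∀ y, ‖u σ y‖ ≤ M)
    (hmild : ∀ s t : ℝ, s ∈ Icc (τ - η) (τ + η) → t ∈ Icc (τ - η) (τ + η) → s < t → ∀ x,
      u t x = heatExtension (u s) (t - s) x - oseenDuhamel 1 s u u t x)
    {δ : ℝ} (hδ : 0 < δ) (c e : EuclideanSpace ℝ (Fin 3)) :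
    ∫ x, (p τ x * fderiv ℝ (Δ (newtonReg δ)) (c - x) e +
        evalDiag (u τ x) (fderiv ℝ (fderiv ℝ (fderiv ℝ (newtonReg δ))) (c - x) e)) = 0 := by
  set cE : ℝ := (2 : ℝ) ^ ((Module.finrank ℝ (EuclideanSpace ℝ (Fin 3)) : ℝ) / 2) with hcE
  set KΘ : ℝ := (3 / 2) * cE + 8 * 64 * cE ^ 3 with hKΘ
  have hcE0 : 0 ≤ cE := by positivity
  have hKΘ0 : 0 ≤ KΘ := by positivity
  have hτI : τ ∈ Icc (τ - η) (τ + η) := ⟨by linarith, by linarith⟩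
  have hτ : τ ∈ S := hI hτI
  have hMτ : ∀ y, ‖u τ y‖ ≤ M := hM τ hτI
  -- the slice data
  have hu : ContDiff ℝ ∞ (u τ) := hcl.contDiff_velocity hτ
  have hp : ContDiff ℝ ∞ (p τ) := hcl.contDiff_pressure hτ
  have hum : AEStronglyMeasurable (u τ) volume := hu.continuous.aestronglyMeasurable
  set A : ℝ≥0∞ := ENNReal.ofReal (M ^ 2) * volume (ball (0 : EuclideanSpace ℝ (Fin 3)) 1) with hA
  have hAtop : A ≠ ⊤ := ENNReal.mul_ne_top ENNReal.ofReal_ne_top measure_ball_lt_top.ne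
  have hAb : ∀ z : EuclideanSpace ℝ (Fin 3), ∫⁻ y in ball z 1, ‖u τ y‖ₑ ^ 2 ≤ A := lintegral_ball_le_of_bound hMτ
  have hpl : LocallyIntegrable (p τ) volume := hp.continuous.locallyIntegrable
  -- the slice Poisson equation
  have hcl' : IsClassicalNSSolutionOn S 1 (fun _ _ => 0) u p := hcl
  have hdrift := isClassicalDriftNSSolutionOn_self_iff.2 hcl'
  have hP : ∀ θ : EuclideanSpace ℝ (Fin 3) → ℝ,
      FunctionSpaces.IsTestFunctionOn (⊤ : TopologicalSpace.Opens (EuclideanSpace ℝ (Fin 3))) θ →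
        ∫ x, p τ x * Δ θ x = -∫ x, fderiv ℝ (fderiv ℝ θ) x (u τ x) (u τ x) := fun θ hθ =>
    hdrift.integral_pressure_mul_laplacian (by rw [hS.interior_eq]; exact hτ) hθ.contDiff hθ.hasCompactSupport
  -- the masses of the profile `λ₁ = newtonFarLaplacian (1/2) 1` and of `D³Φ₁`
  set A₀ : ℝ := ∫ w : EuclideanSpace ℝ (Fin 3), |newtonFarLaplacian (1 / 2) 1 w| with hA₀
  set A₁ : ℝ := ∫ z : EuclideanSpace ℝ (Fin 3), ‖fderiv ℝ (newtonFarLaplacian (1 / 2) 1) z‖ with hA₁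
  set A₂ : ℝ := ∫ z : EuclideanSpace ℝ (Fin 3), ‖fderiv ℝ (fderiv ℝ (newtonFarLaplacian (1 / 2) 1)) z‖ with hA₂
  set A₃ : ℝ := ∫ z : EuclideanSpace ℝ (Fin 3), ‖Δ (newtonFarLaplacian (1 / 2) 1) z‖ with hA₃
  set A₄ : ℝ := ∫ z : EuclideanSpace ℝ (Fin 3), ‖fderiv ℝ (fderiv ℝ (fderiv ℝ (newtonReg (1 : ℝ)))) z‖ with hA₄
  have hA₀0 : 0 ≤ A₀ := integral_nonneg fun _ => abs_nonneg _
  have hA₁0 : 0 ≤ A₁ := integral_nonneg fun _ => norm_nonneg _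
  have hA₂0 : 0 ≤ A₂ := integral_nonneg fun _ => norm_nonneg _
  have hA₃0 : 0 ≤ A₃ := integral_nonneg fun _ => norm_nonneg _
  have hA₄0 : 0 ≤ A₄ := integral_nonneg fun _ => norm_nonneg _
  set Ctot : ℝ := ‖e‖ * (M ^ 2 * A₄ + 2 * (M * A₃) + 2 * (M ^ 2 * A₁) +
    M ^ 2 * (cE * 2 * A₂ + KΘ * 2 * A₀)) with hCtot
  -- the bound at every scale `R ≥ 1`
  set g : ℝ := ∫ x, (p τ x * fderiv ℝ (Δ (newtonReg δ)) (c - x) e +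
      evalDiag (u τ x) (fderiv ℝ (fderiv ℝ (fderiv ℝ (newtonReg δ))) (c - x) e)) with hg
  have hscale : ∀ R : ℝ, 1 ≤ R → |g| ≤ Ctot / R := by
    intro R hR1
    have hR : 0 < R := by linarith
    have hRinv : R⁻¹ ≤ 1 := inv_le_one_of_one_le₀ hR1
    have hRinv0 : 0 ≤ R⁻¹ := by positivity
    -- switch to the scale `R`
    have hswitch := sliceFunctional_eq_of_poisson hδ hR hum hAtop hAb hpl hP c e
    rw [hg, hswitch]
    set θ : EuclideanSpace ℝ (Fin 3) → ℝ := fun x => Δ (newtonReg R) (c - x) with hθ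
    have hθtest := isTestFunctionOn_laplacian_newtonReg_comp_sub hR c
    -- split the functional
    have hp1 := integrable_pressureTerm hR hpl c e
    have hv1 := integrable_evalDiag_fderiv3_newtonReg hR hum hAtop hAb c e
    rw [integral_add hp1 hv1]
    -- the velocity term
    have hN := integral_norm_fderiv3_newtonReg_comp_sub_mul_le hR hMτ c e
    -- the pressure term: integrate by parts and insert the momentum equation
    have hibp : ∫ x, p τ x * fderiv ℝ (Δ (newtonReg R)) (c - x) e = ∫ x, fderiv ℝ (p τ) x e * θ x :=
      pressureTerm_eq_integral_fderiv_mul (contDiff_infty.1 hp 1) (contDiff_laplacian_newtonReg hR (n := 1))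
        (hasCompactSupport_laplacian_newtonReg hR) c e
    have hmom : ∀ x, fderiv ℝ (p τ) x e =
        ⟪Δ (u τ) x, e⟫ - ⟪timeDerivWithin S u τ x, e⟫ - ⟪convect (u τ) (u τ) x, e⟫ := by
      intro x
      have hm := hcl.momentum τ hτ x
      have hgrad : gradient (p τ) x = Δ (u τ) x - timeDerivWithin S u τ x - convect (u τ) (u τ) x := by
        simp only [one_smul, Pi.zero_apply, add_zero] at hm
        have h2 : gradient (p τ) x = Δ (u τ) x - (timeDerivWithin S u τ x + convect (u τ) (u τ) x) := by
          rw [hm]; abel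
        rw [h2]; abel
      rw [← InnerProductSpace.toDual_symm_apply, ← gradient, hgrad, inner_sub_left, inner_sub_left]
    -- integrability of the three pieces
    have hθc : Continuous θ := hθtest.contDiff.continuous
    have hθs : HasCompactSupport θ := hθtest.hasCompactSupport
    have hΔuc : Continuous (Δ (u τ)) := FluidPDE.continuous_laplacian (contDiff_infty.1 hu 2)
    have hdtc : Continuous (timeDerivWithin S u τ) := by
      have h1 : ContDiff ℝ ∞ (fun y => deriv (fun s => u s y) τ) :=
        (hcl.smooth_velocity.isSmoothSpaceTimeOn_deriv hS).contDiff_slice hτ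
      have h2 : timeDerivWithin S u τ = fun y => deriv (fun s => u s y) τ := by
        funext y; exact timeDerivWithin_eq_deriv hS hτ u y
      rw [h2]; exact h1.continuous
    have hcvc : Continuous (convect (u τ) (u τ)) :=
      ((contDiff_infty.1 hu 1).continuous_fderiv one_ne_zero).clm_apply hu.continuous
    have hi1 : Integrable (fun x => ⟪Δ (u τ) x, e⟫ * θ x) volume :=
      ((hΔuc.inner continuous_const).mul hθc).integrable_of_hasCompactSupport hθs.mul_left
    have hi2 : Integrable (fun x => ⟪timeDerivWithin S u τ x, e⟫ * θ x) volume :=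
      ((hdtc.inner continuous_const).mul hθc).integrable_of_hasCompactSupport hθs.mul_left
    have hi3 : Integrable (fun x => ⟪convect (u τ) (u τ) x, e⟫ * θ x) volume :=
      ((hcvc.inner continuous_const).mul hθc).integrable_of_hasCompactSupport hθs.mul_left
    have hP3 : ∫ x, fderiv ℝ (p τ) x e * θ x =
        (∫ x, ⟪Δ (u τ) x, e⟫ * θ x) - (∫ x, ⟪timeDerivWithin S u τ x, e⟫ * θ x) -
          ∫ x, ⟪convect (u τ) (u τ) x, e⟫ * θ x := by
      have h1 : ∀ x, fderiv ℝ (p τ) x e * θ x =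
          ⟪Δ (u τ) x, e⟫ * θ x - ⟪timeDerivWithin S u τ x, e⟫ * θ x - ⟪convect (u τ) (u τ) x, e⟫ * θ x := by
        intro x; rw [hmom]; ring
      have hi12 : Integrable (fun x => ⟪Δ (u τ) x, e⟫ * θ x - ⟪timeDerivWithin S u τ x, e⟫ * θ x) volume :=
        hi1.sub hi2
      simp_rw [h1]
      rw [integral_sub hi12 hi3, integral_sub hi1 hi2]
    rw [hibp, hP3]
    -- the three bounds at scale `R`
    have hB1 := abs_integral_inner_laplacian_mul_le (contDiff_infty.1 hu 2) hMτ hθtest e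
    have hB3 := abs_integral_inner_convect_mul_le (contDiff_infty.1 hu 1) (hcl.divFree τ hτ) hMτ hθtest e
    have hB2 := abs_integral_inner_timeDeriv_mul_le hS hcl hη hI hM0 hM hmild hθtest e hR
    rw [integral_norm_laplacian_bump hR c] at hB1 hB2
    rw [integral_norm_fderiv_bump hR c] at hB3 hB2
    rw [integral_norm_fderiv2_bump hR c, integral_abs_bump hR c] at hB2
    -- collect
    have hR2 : R⁻¹ ^ 2 ≤ R⁻¹ := by
      rw [sq]; exact mul_le_of_le_one_left hRinv0 hRinv
    have hsum : |((∫ x, ⟪Δ (u τ) x, e⟫ * θ x) - (∫ x, ⟪timeDerivWithin S u τ x, e⟫ * θ x) -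
        ∫ x, ⟪convect (u τ) (u τ) x, e⟫ * θ x) +
        ∫ x, evalDiag (u τ x) (fderiv ℝ (fderiv ℝ (fderiv ℝ (newtonReg R))) (c - x) e)| ≤
        M * ‖e‖ * (R⁻¹ ^ 2 * A₃) +
        ‖e‖ * (M * (R⁻¹ ^ 2 * A₃) + M ^ 2 * (R⁻¹ * A₁ + cE * (2 * R) * (R⁻¹ ^ 2 * A₂) + KΘ * (2 / R) * A₀)) +
        M ^ 2 * ‖e‖ * (R⁻¹ * A₁) + M ^ 2 * ‖e‖ * (R⁻¹ * A₄) := by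
      refine (abs_add_le _ _).trans (add_le_add ?_ hN)
      refine (abs_sub _ _).trans (add_le_add ((abs_sub _ _).trans (add_le_add hB1 hB2)) hB3)
    refine hsum.trans ?_
    have he : 0 ≤ ‖e‖ := norm_nonneg _
    have hA3' : R⁻¹ ^ 2 * A₃ ≤ R⁻¹ * A₃ := mul_le_mul_of_nonneg_right hR2 hA₃0
    have e1 : cE * (2 * R) * (R⁻¹ ^ 2 * A₂) = cE * 2 * A₂ * R⁻¹ := by field_simp
    have e2 : KΘ * (2 / R) * A₀ = KΘ * 2 * A₀ * R⁻¹ := by rw [div_eq_mul_inv]; ring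
    rw [e1, e2]
    calc M * ‖e‖ * (R⁻¹ ^ 2 * A₃) +
          ‖e‖ * (M * (R⁻¹ ^ 2 * A₃) + M ^ 2 * (R⁻¹ * A₁ + cE * 2 * A₂ * R⁻¹ + KΘ * 2 * A₀ * R⁻¹)) +
          M ^ 2 * ‖e‖ * (R⁻¹ * A₁) + M ^ 2 * ‖e‖ * (R⁻¹ * A₄)
        ≤ M * ‖e‖ * (R⁻¹ * A₃) +
          ‖e‖ * (M * (R⁻¹ * A₃) + M ^ 2 * (R⁻¹ * A₁ + cE * 2 * A₂ * R⁻¹ + KΘ * 2 * A₀ * R⁻¹)) +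
          M ^ 2 * ‖e‖ * (R⁻¹ * A₁) + M ^ 2 * ‖e‖ * (R⁻¹ * A₄) := by gcongr
      _ = Ctot / R := by rw [hCtot, div_eq_mul_inv]; ring
  -- `R → ∞`
  have hCtot0 : 0 ≤ Ctot := by positivity
  have hlim : Tendsto (fun R : ℝ => Ctot / R) atTop (𝓝 0) := tendsto_const_nhds.div_atTop tendsto_id
  have habs : |g| ≤ 0 :=
    ge_of_tendsto hlim (by filter_upwards [eventually_ge_atTop (1 : ℝ)] with R hR; exact hscale R hR)
  exact abs_nonpos_iff.1 habs

end Identity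

end Summit.NavierStokesRegularity.NavierStokesRegularity.Theorems.PoloidalWindowDoorPoloidalWindowRigidityPressureGradientIdentity

end
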